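import Mathlib.Analysis.SpecialFunctions.Trigonometric.Deriv
import Summits.QuantumFields.BalabanUV.Beta.EriceFlowEnclosureTwoLoopRate

/-!
# Beta / EriceFlowEnclosureLogPeriodicSums — SERVICE FILE (1∕3): the summand `f(x) = sin(log x)∕x²`, its antiderivative
# `F(x) = (sin log x + cos log x)∕(2x)` (F′ = −f), their Lipschitz ∕ mean-value bounds, two shifted telescoping tails, and THE PHASES:
# `sin(log K) + cos(log K)` HAS NO LIMIT along the naturals and `cos(log t) − sin(log t)` HAS NO LIMIT as t → 0⁺ — what the bottom of the
# modulus scale needs: under (3.73)'s second order ALONE ((T): `|β t − β₀ − β₂t| ≤ C₂t²`) the 1∕K term of (3.76)'s expansion along a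
# renormalized trajectory can be LOG-PERIODIC in the depth, with no letter
# (β-flow team, prover 2 = lower ∕ positivity side, unit `b2b-balaban-beta-bflow-p2`, gen 28; module P2 #45-A; consumed by P2 #45-B
# `EriceFlowEnclosureLogPeriodicLaw`, P2 #45-C `EriceFlowEnclosureLogPeriodicLetter`, P2 #45 ∕ #45b `EriceFlowEnclosureTwoLoopLetterWitness{,End}`)

HONEST FRAMING (page 1 of everything the β sub-cell writes): discharging `BetaPertH` makes Bałaban's UV stability UNCONDITIONAL — a
real constructive-QFT result; it is NOT the continuum limit and NOT the Clay problem.  HONEST DEPENDENCY (cell reorg 2026-08-19,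
verbatim): «continuum YM on T⁴ ⇐ BetaPertH ∧ nine spine estimates (0/9 proved); BetaPertH ⇐ (D1) ∧ (D4) ∧ CAP+tail; G-an2-4 gates
asym, D1 and NE2/3/4.»  THIS MODULE DISCHARGES NOTHING: [folklore] one-variable calculus and trigonometry (no β-function, no lattice, no
interface); the import of P2 #33 `EriceFlowEnclosureTwoLoopRate` only places the file in the lineage's import cone.

WHAT THIS FILE PROVES (0 sorry, 0 def): §0 `sum_Ico_inv_add_sq_le` (`Σ_{K≤i<N} 1∕(i+p)² ≤ 1∕(K+p−1) − 1∕(N+p−1)`, p > 1),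
`sum_Ico_inv_add_cube_le` (`Σ 1∕(i+p)³ ≤ (1∕(K+p−1)² − 1∕(N+p−1)²)∕2`); §1 `hasDerivAt_F` (F′ = −f on ]0, ∞[), `hasDerivAt_f`
(`f′(x) = (cos log x − 2 sin log x)∕x³`), `abs_f_le` (≤ 1∕x²), `abs_fderiv_le` (≤ 3∕x³), `abs_F_le` (≤ 1∕x), `f_lipschitz` (constant 3∕a³ on
[a, ∞[), `F_lipschitz` (1∕a²), `F_mvt` (`F y − F z = f(ξ)(z − y)`, ξ ∈ ]y, z[); §3 `one_le_sin_add_cos` (`sin x + cos x ≥ 1` on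
`[2πm, 2πm + π∕2]`), `sin_add_cos_le_neg_one` (`≤ −1` on `[2πm + π, 2πm + 3π∕2]`), `natCeil_exp_bounds` (`y + 1 ≤ ⌈e^y⌉₊`,
`log ⌈e^y⌉₊ ∈ [y, y + 1]`), **`sin_log_add_cos_log_not_tendsto`** (no limit along ℕ: ≥ 1 at `⌈e^{2πm}⌉₊`, ≤ −1 at `⌈e^{2πm+π}⌉₊`),
`sin_nat_mul_two_pi'`, **`cos_log_sub_sin_log_not_tendsto`** (no limit at 0⁺: = 1 at `e^{−2πm}`, = −1 at `e^{−2πm−π}`).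
NOT CLAIMED: anything about a β-function, (3.62), (3.76), (1.22), `BetaPertH`, continuum, Clay.
-/

namespace Summit.QuantumFields.BalabanUV.Beta.EriceFlowEnclosureLogPeriodicSums

open Set Filter Topology

noncomputable section

/-! ## §0 Two shifted telescoping tails -/

/-- `Σ_{K≤i<N} 1∕(i+p)² ≤ 1∕(K+p−1) − 1∕(N+p−1)` for `p > 1` (since `1∕(i+p)² ≤ 1∕(i+p−1) − 1∕(i+p)`). [folklore] -/
theorem sum_Ico_inv_add_sq_le {p : ℝ} (hp : 1 < p) {K N : ℕ} (hKN : K ≤ N) :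
    ∑ i ∈ Finset.Ico K N, 1 / ((i : ℝ) + p) ^ 2 ≤ 1 / ((K : ℝ) + p - 1) - 1 / ((N : ℝ) + p - 1) := by
  induction N, hKN using Nat.le_induction with
  | base => simp
  | succ N hKN ih =>
    rw [Finset.sum_Ico_succ_top hKN]
    have hN0 : (0 : ℝ) ≤ N := N.cast_nonneg
    have hN : (0 : ℝ) < (N : ℝ) + p - 1 := by linarith
    have hx : (0 : ℝ) < (N : ℝ) + p := by linarith
    have e1 : (N : ℝ) + 1 + p - 1 = (N : ℝ) + p := by ring
    have e : 1 / ((N : ℝ) + p - 1) - 1 / ((N : ℝ) + p) = 1 / (((N : ℝ) + p - 1) * ((N : ℝ) + p)) := by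
      rw [div_sub_div _ _ hN.ne' hx.ne', one_mul, mul_one]
      congr 1
      ring
    have hle : 1 / ((N : ℝ) + p) ^ 2 ≤ 1 / (((N : ℝ) + p - 1) * ((N : ℝ) + p)) :=
      one_div_le_one_div_of_le (by positivity) (by nlinarith)
    push_cast
    rw [e1]
    linarith

/-- `Σ_{K≤i<N} 1∕(i+p)³ ≤ (1∕(K+p−1)² − 1∕(N+p−1)²)∕2` for `p > 1` (since `1∕x³ ≤ (1∕(x−1)² − 1∕x²)∕2` for `x ≥ 1`). [folklore] -/
theorem sum_Ico_inv_add_cube_le {p : ℝ} (hp : 1 < p) {K N : ℕ} (hKN : K ≤ N) :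
    ∑ i ∈ Finset.Ico K N, 1 / ((i : ℝ) + p) ^ 3
      ≤ (1 / ((K : ℝ) + p - 1) ^ 2 - 1 / ((N : ℝ) + p - 1) ^ 2) / 2 := by
  induction N, hKN using Nat.le_induction with
  | base => simp
  | succ N hKN ih =>
    rw [Finset.sum_Ico_succ_top hKN]
    have hN0 : (0 : ℝ) ≤ N := N.cast_nonneg
    have hN : (0 : ℝ) < (N : ℝ) + p - 1 := by linarith
    have hx : (0 : ℝ) < (N : ℝ) + p := by linarith
    have e1 : (N : ℝ) + 1 + p - 1 = (N : ℝ) + p := by ring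
    have e : (1 / ((N : ℝ) + p - 1) ^ 2 - 1 / ((N : ℝ) + p) ^ 2) / 2
        = (2 * ((N : ℝ) + p) - 1) / (2 * (((N : ℝ) + p - 1) ^ 2 * ((N : ℝ) + p) ^ 2)) := by
      rw [div_sub_div _ _ (pow_ne_zero 2 hN.ne') (pow_ne_zero 2 hx.ne'), one_mul, mul_one,
        div_div]
      congr 1
      · ring
      · ring
    have hle : 1 / ((N : ℝ) + p) ^ 3 ≤ (2 * ((N : ℝ) + p) - 1) / (2 * (((N : ℝ) + p - 1) ^ 2 * ((N : ℝ) + p) ^ 2)) := by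
      rw [div_le_div_iff₀ (by positivity) (by positivity)]
      have h3 : ((N : ℝ) + p) ^ 3 = ((N : ℝ) + p) * ((N : ℝ) + p) ^ 2 := by ring
      rw [h3]
      have h1 : 1 * (2 * (((N : ℝ) + p - 1) ^ 2 * ((N : ℝ) + p) ^ 2))
          = (2 * ((N : ℝ) + p - 1) ^ 2) * ((N : ℝ) + p) ^ 2 := by ring
      have h2 : (2 * ((N : ℝ) + p) - 1) * (((N : ℝ) + p) * ((N : ℝ) + p) ^ 2)
          = ((2 * ((N : ℝ) + p) - 1) * ((N : ℝ) + p)) * ((N : ℝ) + p) ^ 2 := by ring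
      rw [h1, h2]
      exact mul_le_mul_of_nonneg_right (by nlinarith) (by positivity)
    push_cast
    rw [e1]
    linarith

/-! ## §1 The summand `f(x) = sin(log x)∕x²` and its antiderivative `F(x) = (sin log x + cos log x)∕(2x)` -/

/-- `F(x) = (sin(log x) + cos(log x))∕(2x)` has derivative `−sin(log x)∕x²` at every `x > 0`. [folklore] -/
theorem hasDerivAt_F {x : ℝ} (hx : 0 < x) :
    HasDerivAt (fun x : ℝ => (Real.sin (Real.log x) + Real.cos (Real.log x)) / (2 * x))
      (-(Real.sin (Real.log x) / x ^ 2)) x := by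
  have hl : HasDerivAt Real.log x⁻¹ x := Real.hasDerivAt_log hx.ne'
  have hnum : HasDerivAt (fun x => Real.sin (Real.log x) + Real.cos (Real.log x))
      (Real.cos (Real.log x) * x⁻¹ + -Real.sin (Real.log x) * x⁻¹) x := hl.sin.add hl.cos
  have hden : HasDerivAt (fun x : ℝ => 2 * x) 2 x := by
    simpa using (hasDerivAt_id x).const_mul (2 : ℝ)
  refine (hnum.div hden (mul_ne_zero two_ne_zero hx.ne')).congr_deriv ?_
  field_simp
  ring

/-- `f(x) = sin(log x)∕x²` has derivative `(cos(log x) − 2 sin(log x))∕x³` at every `x > 0`. [folklore] -/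
theorem hasDerivAt_f {x : ℝ} (hx : 0 < x) :
    HasDerivAt (fun x : ℝ => Real.sin (Real.log x) / x ^ 2)
      ((Real.cos (Real.log x) - 2 * Real.sin (Real.log x)) / x ^ 3) x := by
  have hl : HasDerivAt Real.log x⁻¹ x := Real.hasDerivAt_log hx.ne'
  have hden : HasDerivAt (fun x : ℝ => x ^ 2) (2 * x) x := by
    simpa using hasDerivAt_pow 2 x
  refine (hl.sin.div hden (pow_ne_zero 2 hx.ne')).congr_deriv ?_
  field_simp

/-- `|sin(log x)∕x²| ≤ 1∕x²` (x > 0). [folklore] -/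
theorem abs_f_le {x : ℝ} (hx : 0 < x) : |Real.sin (Real.log x) / x ^ 2| ≤ 1 / x ^ 2 := by
  rw [abs_div, abs_of_pos (pow_pos hx 2)]
  gcongr
  exact Real.abs_sin_le_one _

/-- `|f′(x)| ≤ 3∕x³` (x > 0). [folklore] -/
theorem abs_fderiv_le {x : ℝ} (hx : 0 < x) :
    |(Real.cos (Real.log x) - 2 * Real.sin (Real.log x)) / x ^ 3| ≤ 3 / x ^ 3 := by
  rw [abs_div, abs_of_pos (pow_pos hx 3)]
  gcongr
  calc |Real.cos (Real.log x) - 2 * Real.sin (Real.log x)|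
      ≤ |Real.cos (Real.log x)| + |2 * Real.sin (Real.log x)| := abs_sub _ _
    _ ≤ 1 + 2 * 1 := by
        rw [abs_mul, abs_two]
        exact add_le_add (Real.abs_cos_le_one _)
          (mul_le_mul_of_nonneg_left (Real.abs_sin_le_one _) zero_le_two)
    _ = 3 := by norm_num

/-- `|F(x)| ≤ 1∕x` (x > 0). [folklore] -/
theorem abs_F_le {x : ℝ} (hx : 0 < x) :
    |(Real.sin (Real.log x) + Real.cos (Real.log x)) / (2 * x)| ≤ 1 / x := by
  rw [abs_div, abs_of_pos (by positivity : (0 : ℝ) < 2 * x), div_le_div_iff₀ (by positivity) hx]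
  have h : |Real.sin (Real.log x) + Real.cos (Real.log x)| ≤ 2 := by
    calc |Real.sin (Real.log x) + Real.cos (Real.log x)|
        ≤ |Real.sin (Real.log x)| + |Real.cos (Real.log x)| := abs_add_le _ _
      _ ≤ 1 + 1 := add_le_add (Real.abs_sin_le_one _) (Real.abs_cos_le_one _)
      _ = 2 := by norm_num
  nlinarith [abs_nonneg (Real.sin (Real.log x) + Real.cos (Real.log x))]

/-- **f is Lipschitz with constant 3∕a³ on [a, ∞[** (a > 0). [folklore] -/
theorem f_lipschitz {a y z : ℝ} (ha : 0 < a) (hy : a ≤ y) (hz : a ≤ z) :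
    |Real.sin (Real.log y) / y ^ 2 - Real.sin (Real.log z) / z ^ 2| ≤ 3 / a ^ 3 * |y - z| := by
  have hder : ∀ x ∈ Ici a, HasDerivWithinAt (fun x : ℝ => Real.sin (Real.log x) / x ^ 2)
      ((Real.cos (Real.log x) - 2 * Real.sin (Real.log x)) / x ^ 3) (Ici a) x :=
    fun x hx => (hasDerivAt_f (ha.trans_le hx)).hasDerivWithinAt
  have hbound : ∀ x ∈ Ici a, ‖(Real.cos (Real.log x) - 2 * Real.sin (Real.log x)) / x ^ 3‖ ≤ 3 / a ^ 3 := by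
    intro x hx
    have hx0 : 0 < x := ha.trans_le hx
    rw [Real.norm_eq_abs]
    refine (abs_fderiv_le hx0).trans ?_
    exact div_le_div_of_nonneg_left (by norm_num) (pow_pos ha 3) (pow_le_pow_left₀ ha.le hx 3)
  have h := (convex_Ici a).norm_image_sub_le_of_norm_hasDerivWithin_le hder hbound hz hy
  rw [Real.norm_eq_abs, Real.norm_eq_abs] at h
  exact h

/-- **F is Lipschitz with constant 1∕a² on [a, ∞[** (a > 0). [folklore] -/
theorem F_lipschitz {a y z : ℝ} (ha : 0 < a) (hy : a ≤ y) (hz : a ≤ z) :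
    |(Real.sin (Real.log y) + Real.cos (Real.log y)) / (2 * y)
        - (Real.sin (Real.log z) + Real.cos (Real.log z)) / (2 * z)| ≤ 1 / a ^ 2 * |y - z| := by
  have hder : ∀ x ∈ Ici a, HasDerivWithinAt (fun x : ℝ => (Real.sin (Real.log x) + Real.cos (Real.log x)) / (2 * x))
      (-(Real.sin (Real.log x) / x ^ 2)) (Ici a) x :=
    fun x hx => (hasDerivAt_F (ha.trans_le hx)).hasDerivWithinAt
  have hbound : ∀ x ∈ Ici a, ‖-(Real.sin (Real.log x) / x ^ 2)‖ ≤ 1 / a ^ 2 := by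
    intro x hx
    have hx0 : 0 < x := ha.trans_le hx
    rw [Real.norm_eq_abs, abs_neg]
    refine (abs_f_le hx0).trans ?_
    exact div_le_div_of_nonneg_left zero_le_one (pow_pos ha 2) (pow_le_pow_left₀ ha.le hx 2)
  have h := (convex_Ici a).norm_image_sub_le_of_norm_hasDerivWithin_le hder hbound hz hy
  rw [Real.norm_eq_abs, Real.norm_eq_abs] at h
  exact h

/-- **The mean value form of one telescoping step**: for `0 < y < z` there is `ξ ∈ ]y, z[` with
`F(y) − F(z) = f(ξ)·(z − y)`. [folklore] -/
theorem F_mvt {y z : ℝ} (hy : 0 < y) (hyz : y < z) :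
    ∃ ξ ∈ Ioo y z, (Real.sin (Real.log y) + Real.cos (Real.log y)) / (2 * y)
        - (Real.sin (Real.log z) + Real.cos (Real.log z)) / (2 * z)
      = Real.sin (Real.log ξ) / ξ ^ 2 * (z - y) := by
  have hcont : ContinuousOn (fun x : ℝ => (Real.sin (Real.log x) + Real.cos (Real.log x)) / (2 * x)) (Icc y z) :=
    fun x hx => (hasDerivAt_F (hy.trans_le hx.1)).continuousAt.continuousWithinAt
  obtain ⟨ξ, hξ, hslope⟩ := exists_hasDerivAt_eq_slope
    (fun x : ℝ => (Real.sin (Real.log x) + Real.cos (Real.log x)) / (2 * x))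
    (fun x => -(Real.sin (Real.log x) / x ^ 2)) hyz hcont
    (fun x hx => hasDerivAt_F (hy.trans hx.1))
  refine ⟨ξ, hξ, ?_⟩
  have hne : z - y ≠ 0 := sub_ne_zero.mpr hyz.ne'
  rw [eq_div_iff hne] at hslope
  linarith

/-! ## §3 Phases: `sin x + cos x` on the quarter periods, and `sin(log K) + cos(log K)` has no limit -/

/-- On `[2πm, 2πm + π∕2]`: `sin x ≥ 0`, `cos x ≥ 0`, hence `sin x + cos x ≥ 1` (`(sin + cos)² = 1 + 2 sin·cos ≥ 1`). [folklore] -/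
theorem one_le_sin_add_cos {x : ℝ} {m : ℕ} (h1 : (m : ℝ) * (2 * Real.pi) ≤ x) (h2 : x ≤ (m : ℝ) * (2 * Real.pi) + Real.pi / 2) :
    1 ≤ Real.sin x + Real.cos x := by
  set y := x - (m : ℝ) * (2 * Real.pi) with hy
  have hx : x = y + (m : ℝ) * (2 * Real.pi) := by rw [hy]; ring
  have hy0 : 0 ≤ y := by rw [hy]; linarith
  have hy1 : y ≤ Real.pi / 2 := by rw [hy]; linarith
  rw [hx, Real.sin_add_nat_mul_two_pi, Real.cos_add_nat_mul_two_pi]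
  have hs : 0 ≤ Real.sin y := Real.sin_nonneg_of_nonneg_of_le_pi hy0 (by linarith [Real.pi_pos])
  have hc : 0 ≤ Real.cos y := Real.cos_nonneg_of_neg_pi_div_two_le_of_le (by linarith [Real.pi_pos]) hy1
  nlinarith [Real.sin_sq_add_cos_sq y, mul_nonneg hs hc]

/-- On `[2πm + π, 2πm + 3π∕2]`: `sin x + cos x ≤ −1` (shift by π). [folklore] -/
theorem sin_add_cos_le_neg_one {x : ℝ} {m : ℕ} (h1 : (m : ℝ) * (2 * Real.pi) + Real.pi ≤ x)
    (h2 : x ≤ (m : ℝ) * (2 * Real.pi) + Real.pi + Real.pi / 2) :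
    Real.sin x + Real.cos x ≤ -1 := by
  have h := one_le_sin_add_cos (x := x - Real.pi) (m := m) (by linarith) (by linarith)
  have hx : x = (x - Real.pi) + Real.pi := by ring
  rw [hx, Real.sin_add_pi, Real.cos_add_pi]
  linarith

/-- `⌈e^y⌉₊` for `y ≥ 0`: `y + 1 ≤ ⌈e^y⌉₊`, `y ≤ log ⌈e^y⌉₊ ≤ y + 1` (`⌈e^y⌉₊ < e^y + 1 ≤ 2e^y`, `log 2 ≤ 1`). [folklore] -/
theorem natCeil_exp_bounds {y : ℝ} (hy : 0 ≤ y) :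
    y + 1 ≤ (⌈Real.exp y⌉₊ : ℝ) ∧ y ≤ Real.log (⌈Real.exp y⌉₊ : ℝ) ∧ Real.log (⌈Real.exp y⌉₊ : ℝ) ≤ y + 1 := by
  have hexp : Real.exp y ≤ (⌈Real.exp y⌉₊ : ℝ) := Nat.le_ceil _
  have he1 : 1 ≤ Real.exp y := Real.one_le_exp hy
  have hpos : (0 : ℝ) < (⌈Real.exp y⌉₊ : ℝ) := by linarith
  refine ⟨(Real.add_one_le_exp y).trans hexp, ?_, ?_⟩
  · calc y = Real.log (Real.exp y) := (Real.log_exp y).symm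
      _ ≤ Real.log (⌈Real.exp y⌉₊ : ℝ) := Real.log_le_log (Real.exp_pos y) hexp
  · have hlt : (⌈Real.exp y⌉₊ : ℝ) < Real.exp y + 1 := Nat.ceil_lt_add_one (Real.exp_pos y).le
    have hle2 : (⌈Real.exp y⌉₊ : ℝ) ≤ 2 * Real.exp y := by linarith
    calc Real.log (⌈Real.exp y⌉₊ : ℝ) ≤ Real.log (2 * Real.exp y) := Real.log_le_log hpos hle2
      _ = Real.log 2 + y := by rw [Real.log_mul two_ne_zero (Real.exp_pos y).ne', Real.log_exp]
      _ ≤ 1 + y := by linarith [Real.log_le_sub_one_of_pos (by norm_num : (0 : ℝ) < 2)]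
      _ = y + 1 := by ring

/-- **`sin(log K) + cos(log K)` HAS NO LIMIT along the natural numbers**: it is `≥ 1` at `K = ⌈e^{2πm}⌉₊` and `≤ −1` at
`K = ⌈e^{2πm + π}⌉₊` for every m (`log 2 ≤ 1 ≤ π∕2`), and both subsequences are cofinal. [folklore] -/
theorem sin_log_add_cos_log_not_tendsto (b : ℝ) :
    ¬ Tendsto (fun K : ℕ => Real.sin (Real.log K) + Real.cos (Real.log K)) atTop (𝓝 b) := by
  intro h
  obtain ⟨N, hN⟩ := Metric.tendsto_atTop.mp h 1 one_pos
  have hπ : 1 ≤ Real.pi / 2 := Real.one_le_pi_div_two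
  have hN0 : (0 : ℝ) ≤ N := N.cast_nonneg
  -- the upper subsequence: K₁ = ⌈exp(2πN)⌉₊ ≥ N with sin + cos ≥ 1
  have hy₁ : 0 ≤ (N : ℝ) * (2 * Real.pi) := by positivity
  obtain ⟨hK₁ge, hK₁lo, hK₁hi⟩ := natCeil_exp_bounds hy₁
  have h2π : (1 : ℝ) ≤ 2 * Real.pi := by linarith
  have hN2π : (N : ℝ) ≤ (N : ℝ) * (2 * Real.pi) := by
    have := mul_le_mul_of_nonneg_left h2π hN0
    linarith
  have hK₁N : N ≤ ⌈Real.exp ((N : ℝ) * (2 * Real.pi))⌉₊ := by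
    have : (N : ℝ) ≤ (⌈Real.exp ((N : ℝ) * (2 * Real.pi))⌉₊ : ℝ) := by linarith
    exact_mod_cast this
  have h₁ := hN _ hK₁N
  have hge : 1 ≤ Real.sin (Real.log (⌈Real.exp ((N : ℝ) * (2 * Real.pi))⌉₊ : ℝ))
      + Real.cos (Real.log (⌈Real.exp ((N : ℝ) * (2 * Real.pi))⌉₊ : ℝ)) :=
    one_le_sin_add_cos (m := N) hK₁lo (by linarith)
  rw [Real.dist_eq] at h₁
  have hb₁ : 0 < b := by linarith [(abs_lt.mp h₁).2]
  -- the lower subsequence: K₂ = ⌈exp(2πN + π)⌉₊ ≥ N with sin + cos ≤ −1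
  have hy₂ : 0 ≤ (N : ℝ) * (2 * Real.pi) + Real.pi := by positivity
  obtain ⟨hK₂ge, hK₂lo, hK₂hi⟩ := natCeil_exp_bounds hy₂
  have hK₂N : N ≤ ⌈Real.exp ((N : ℝ) * (2 * Real.pi) + Real.pi)⌉₊ := by
    have : (N : ℝ) ≤ (⌈Real.exp ((N : ℝ) * (2 * Real.pi) + Real.pi)⌉₊ : ℝ) := by linarith [Real.pi_pos]
    exact_mod_cast this
  have h₂ := hN _ hK₂N
  have hle : Real.sin (Real.log (⌈Real.exp ((N : ℝ) * (2 * Real.pi) + Real.pi)⌉₊ : ℝ))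
      + Real.cos (Real.log (⌈Real.exp ((N : ℝ) * (2 * Real.pi) + Real.pi)⌉₊ : ℝ)) ≤ -1 :=
    sin_add_cos_le_neg_one (m := N) hK₂lo (by linarith)
  rw [Real.dist_eq] at h₂
  have hb₂ : b < 0 := by linarith [(abs_lt.mp h₂).1]
  exact lt_irrefl _ (hb₁.trans hb₂)

/-- `sin(m·2π) = 0` (m : ℕ). [folklore] -/
theorem sin_nat_mul_two_pi' (m : ℕ) : Real.sin ((m : ℝ) * (2 * Real.pi)) = 0 := by
  rw [show (m : ℝ) * (2 * Real.pi) = ((2 * m : ℕ) : ℝ) * Real.pi by push_cast; ring]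
  exact Real.sin_nat_mul_pi _

/-- **`cos(log t) − sin(log t)` HAS NO LIMIT as `t → 0⁺`**: it is `1` at `t = e^{−2πm}` and `−1` at `t = e^{−2πm−π}`, both sequences
tending to 0⁺. [folklore] -/
theorem cos_log_sub_sin_log_not_tendsto (b : ℝ) :
    ¬ Tendsto (fun t : ℝ => Real.cos (Real.log t) - Real.sin (Real.log t)) (𝓝[>] 0) (𝓝 b) := by
  intro h
  -- the two sequences
  have hlin : Tendsto (fun m : ℕ => (m : ℝ) * (2 * Real.pi)) atTop atTop :=
    tendsto_natCast_atTop_atTop.atTop_mul_const (by positivity)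
  have hlin' : Tendsto (fun m : ℕ => (m : ℝ) * (2 * Real.pi) + Real.pi) atTop atTop :=
    tendsto_atTop_add_const_right _ _ hlin
  have hseq : ∀ {x : ℕ → ℝ}, Tendsto x atTop atTop →
      Tendsto (fun m => Real.exp (-x m)) atTop (𝓝[>] 0) := by
    intro x hx
    refine tendsto_nhdsWithin_iff.mpr ⟨Real.tendsto_exp_neg_atTop_nhds_zero.comp hx, ?_⟩
    exact Filter.Eventually.of_forall fun m => Real.exp_pos _
  have h₁ := h.comp (hseq hlin)
  have h₂ := h.comp (hseq hlin')
  have e₁ : ∀ m : ℕ, Real.cos (Real.log (Real.exp (-((m : ℝ) * (2 * Real.pi)))))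
      - Real.sin (Real.log (Real.exp (-((m : ℝ) * (2 * Real.pi))))) = 1 := by
    intro m
    rw [Real.log_exp, Real.cos_neg, Real.sin_neg, Real.cos_nat_mul_two_pi, sin_nat_mul_two_pi']
    ring
  have e₂ : ∀ m : ℕ, Real.cos (Real.log (Real.exp (-((m : ℝ) * (2 * Real.pi) + Real.pi))))
      - Real.sin (Real.log (Real.exp (-((m : ℝ) * (2 * Real.pi) + Real.pi)))) = -1 := by
    intro m
    rw [Real.log_exp, Real.cos_neg, Real.sin_neg, Real.cos_add_pi, Real.sin_add_pi, Real.cos_nat_mul_two_pi,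
      sin_nat_mul_two_pi']
    ring
  have hb₁ : b = 1 := by
    have h1 : Tendsto (fun _ : ℕ => (1 : ℝ)) atTop (𝓝 b) := h₁.congr fun m => by simp only [Function.comp] ; exact e₁ m
    exact (tendsto_nhds_unique h1 tendsto_const_nhds)
  have hb₂ : b = -1 := by
    have h2 : Tendsto (fun _ : ℕ => (-1 : ℝ)) atTop (𝓝 b) := h₂.congr fun m => by simp only [Function.comp]; exact e₂ m
    exact (tendsto_nhds_unique h2 tendsto_const_nhds)
  linarith

end

end Summit.QuantumFields.BalabanUV.Beta.EriceFlowEnclosureLogPeriodicSums
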